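import Summits.CriticalPhenomena.PercolationContinuityZ3.Theses.PercSubharmonicSquare
import HarnessLib

/-!
# Route PercSubharmonicSquare — support `ExteriorSubharmonicDecay` (stmt-CriticalPhenomena-11507)

Transience of `ℤ³` in maximum-principle form (pure lattice potential theory): for every `R` there
are `b > 0` and `C` such that every `u : ℤ³ → [0,1]` tending to `0` at infinity that is
nearest-neighbour subharmonic at every site `x` with `‖x‖∞ > R` satisfies `u x ≤ C ‖x‖∞^{-b}` for
all `x ≠ 0`.  We take `b = 1/2` and `C = (600 + 3 R²)^{1/4}`.

Proof.

* Barrier.  `h(x) := (600 + x₁² + x₂² + x₃²)^{-1/4}` is positive and lattice-SUPERharmonic on all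
  of `ℤ³`: `Σ_{y ∼ x} h(y) ≤ 6 h(x)`.  Root-free verification: with `Q := 600 + |x|²` the six
  neighbours have `|y|² = |x|² + δ`, `δ = 1 ± 2xᵢ`, and
  `(Q + δ)^{-1/4} ≤ Q^{-1/4} (1 - δ/(4Q) + (3/16) δ²/Q²)` because, raised to the fourth power and
  multiplied by `Q + δ`, this is the polynomial inequality `1 ≤ (1+ε)(1 - ε/4 + 3ε²/16)⁴` for
  `ε = δ/Q`, `ε² ≤ 1/100` (`rpow_neg_quarter_add_le`, `one_le_poly_of_sq_le`); summing,
  `Σ δ = 6`, `Σ δ² = 6 + 8|x|²`, and `6 - 3/(2Q) + 3(6 + 8|x|²)/(16Q²) ≤ 6` since `Q = 600 + |x|²`.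
* Exterior maximum principle (`exterior_maximum_principle`): if `w ≤ 0` on `Λ_R`, `{w ≥ ε}` is
  finite for every `ε > 0`, and `w` is subharmonic off `Λ_R`, then `w ≤ 0` everywhere — a
  maximiser of `w` with maximal first coordinate has its neighbour `x + e₀` again a maximiser.
* Apply it to `w := u - C₀ h`, `C₀ := (600 + 3R²)^{1/4}` (`C₀ h ≥ 1 ≥ u` on `Λ_R`), and use
  `h(x) ≤ (‖x‖∞²)^{-1/4} = ‖x‖∞^{-1/2}`.

Sources: Lawler–Limic, *Random Walk: A Modern Introduction* (2010) §6.5 (maximum principle);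
Lawler, *Intersections of Random Walks* (1991) §1.4–1.5.  No percolation input.
-/

noncomputable section

namespace Summit.CriticalPhenomena.PercolationContinuityZ3.Theorems

open Filter Literature.Probability.LatticeModels
open scoped Topology BigOperators

/-! ### The one-variable polynomial inequality behind the barrier -/

/-- For `ε² ≤ 1/100`: `1 ≤ (1 + ε) (1 - ε/4 + (3/16) ε²)⁴`.  (The left factor times the fourth
power of the degree-two Taylor-type majorant of `(1+ε)^{-1/4}`; the difference is
`ε² (1/8 + ε/2 - …) ≥ 0` on `|ε| ≤ 1/10`.) -/
theorem one_le_poly_of_sq_le (e : ℝ) (he : e ^ 2 ≤ 1 / 100) :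
    1 ≤ (1 + e) * (1 - e / 4 + 3 / 16 * e ^ 2) ^ 4 := by
  have h1 : -(1 / 10) ≤ e := by nlinarith [sq_nonneg (e + 1 / 10), sq_nonneg (e - 1 / 10)]
  have h2 : e ≤ 1 / 10 := by nlinarith [sq_nonneg (e + 1 / 10), sq_nonneg (e - 1 / 10)]
  have h3 : 0 ≤ e ^ 2 := sq_nonneg e
  have h4 : 0 ≤ e ^ 4 := by positivity
  have h5 : 0 ≤ e ^ 6 := by positivity
  nlinarith [mul_nonneg h3 (sub_nonneg.2 h1), mul_nonneg h3 (sub_nonneg.2 h2),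
    mul_nonneg h4 (sub_nonneg.2 h1), mul_nonneg h4 (sub_nonneg.2 h2),
    mul_nonneg h5 (sub_nonneg.2 h1), mul_nonneg h5 (sub_nonneg.2 h2),
    mul_nonneg h3 (sub_nonneg.2 he), mul_nonneg h4 (sub_nonneg.2 he),
    mul_nonneg h5 (sub_nonneg.2 he)]

/-- Root-free one-step bound for the barrier profile `t ↦ t^{-1/4}`: for `Q > 0` and
`δ² ≤ Q²/100`, `(Q + δ)^{-1/4} ≤ Q^{-1/4} (1 - δ/(4Q) + 3δ²/(16Q²))`. -/
theorem rpow_neg_quarter_add_le (Q δ : ℝ) (hQ : 0 < Q) (hδ : δ ^ 2 ≤ Q ^ 2 / 100) :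
    (Q + δ) ^ (-(1 / 4 : ℝ)) ≤
      Q ^ (-(1 / 4 : ℝ)) * (1 - δ / (4 * Q) + 3 * δ ^ 2 / (16 * Q ^ 2)) := by
  set ε : ℝ := δ / Q with hε
  have hδε : δ = ε * Q := by rw [hε]; field_simp
  have hε2 : ε ^ 2 ≤ 1 / 100 := by
    rw [hε, div_pow, div_le_iff₀ (by positivity)]
    linarith
  have hpoly := one_le_poly_of_sq_le ε hε2
  have hg : 0 < 1 - ε / 4 + 3 / 16 * ε ^ 2 := by nlinarith [sq_nonneg (ε - 2 / 3)]
  have hε1 : -(1 / 10) ≤ ε := by nlinarith [sq_nonneg (ε + 1 / 10), sq_nonneg (ε - 1 / 10)]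
  have ht : 0 < Q + δ := by rw [hδε]; nlinarith
  have hfac : 1 - δ / (4 * Q) + 3 * δ ^ 2 / (16 * Q ^ 2) = 1 - ε / 4 + 3 / 16 * ε ^ 2 := by
    rw [hε]
    field_simp
  rw [hfac]
  have hQr : 0 < Q ^ (-(1 / 4 : ℝ)) := Real.rpow_pos_of_pos hQ _
  refine le_of_pow_le_pow_left₀ (n := 4) (by norm_num) (mul_pos hQr hg).le ?_
  have hl : ((Q + δ) ^ (-(1 / 4 : ℝ))) ^ 4 = (Q + δ)⁻¹ := by
    rw [← Real.rpow_natCast, ← Real.rpow_mul ht.le]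
    norm_num
    exact Real.rpow_neg_one _
  have hr : (Q ^ (-(1 / 4 : ℝ))) ^ 4 = Q⁻¹ := by
    rw [← Real.rpow_natCast, ← Real.rpow_mul hQ.le]
    norm_num
    exact Real.rpow_neg_one _
  rw [mul_pow, hl, hr, inv_eq_one_div, inv_eq_one_div, div_mul_eq_mul_div, one_mul,
    div_le_div_iff₀ ht hQ, one_mul, hδε]
  have : Q ≤ Q * ((1 + ε) * (1 - ε / 4 + 3 / 16 * ε ^ 2) ^ 4) :=
    le_mul_of_one_le_right hQ.le hpoly
  nlinarith [this]

/-! ### The barrier `(600 + |x|²)^{-1/4}` on `ℤ³` -/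

/-- `|x + eᵢ|² = |x|² + (2xᵢ + 1)` on `ℤ³` (squared Euclidean norm, real-valued). -/
theorem sum_sq_add_single (x : Site 3) (i : Fin 3) :
    (∑ j, (((x + Pi.single i 1 : Site 3) j : ℤ) : ℝ) ^ 2) =
      (∑ j, ((x j : ℤ) : ℝ) ^ 2) + (2 * ((x i : ℤ) : ℝ) + 1) := by
  fin_cases i <;> simp [Fin.sum_univ_three, Pi.single_apply] <;> ring

/-- `|x - eᵢ|² = |x|² + (1 - 2xᵢ)` on `ℤ³` (squared Euclidean norm, real-valued). -/
theorem sum_sq_sub_single (x : Site 3) (i : Fin 3) :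
    (∑ j, (((x - Pi.single i 1 : Site 3) j : ℤ) : ℝ) ^ 2) =
      (∑ j, ((x j : ℤ) : ℝ) ^ 2) + (1 - 2 * ((x i : ℤ) : ℝ)) := by
  fin_cases i <;> simp [Fin.sum_univ_three, Pi.single_apply] <;> ring

/-- **The barrier is lattice-superharmonic on all of `ℤ³`.**  For `h(x) := (600 + |x|²)^{-1/4}`
and every site `x`, `Σᵢ (h(x + eᵢ) + h(x - eᵢ)) ≤ 6 h(x)`: each neighbour is bounded by
`rpow_neg_quarter_add_le` with `Q = 600 + |x|²`, `δ = 1 ± 2xᵢ` (`δ² ≤ 3 + 6xᵢ² ≤ 6Q ≤ Q²/100`),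
and the six majorants sum to `h(x) (6 - 3/(2Q) + (18 + 24|x|²)/(16Q²)) ≤ 6 h(x)`. -/
theorem barrier_superharmonic (x : Site 3) :
    (∑ i : Fin 3, (((600 : ℝ) + ∑ j, (((x + Pi.single i 1 : Site 3) j : ℤ) : ℝ) ^ 2) ^ (-(1 / 4 : ℝ)) +
        ((600 : ℝ) + ∑ j, (((x - Pi.single i 1 : Site 3) j : ℤ) : ℝ) ^ 2) ^ (-(1 / 4 : ℝ)))) ≤
      6 * ((600 : ℝ) + ∑ j, ((x j : ℤ) : ℝ) ^ 2) ^ (-(1 / 4 : ℝ)) := by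
  set q : ℝ := ∑ j, ((x j : ℤ) : ℝ) ^ 2 with hq
  set Q : ℝ := 600 + q with hQ
  have hq0 : 0 ≤ q := Finset.sum_nonneg fun j _ => sq_nonneg _
  have hQpos : 0 < Q := by rw [hQ]; linarith
  have hxi : ∀ i : Fin 3, ((x i : ℤ) : ℝ) ^ 2 ≤ q := fun i =>
    Finset.single_le_sum (f := fun j => ((x j : ℤ) : ℝ) ^ 2) (fun j _ => sq_nonneg _)
      (Finset.mem_univ i)
  have hstep : ∀ δ : ℝ, δ ^ 2 ≤ 6 * Q → (Q + δ) ^ (-(1 / 4 : ℝ)) ≤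
      Q ^ (-(1 / 4 : ℝ)) * (1 - δ / (4 * Q) + 3 * δ ^ 2 / (16 * Q ^ 2)) := by
    intro δ hδ
    refine rpow_neg_quarter_add_le Q δ hQpos ?_
    have h600 : 600 ≤ Q := by rw [hQ]; linarith
    nlinarith
  have hplus : ∀ i : Fin 3,
      ((600 : ℝ) + ∑ j, (((x + Pi.single i 1 : Site 3) j : ℤ) : ℝ) ^ 2) ^ (-(1 / 4 : ℝ)) ≤
        Q ^ (-(1 / 4 : ℝ)) * (1 - (2 * ((x i : ℤ) : ℝ) + 1) / (4 * Q) +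
          3 * (2 * ((x i : ℤ) : ℝ) + 1) ^ 2 / (16 * Q ^ 2)) := by
    intro i
    rw [sum_sq_add_single, ← hq, ← add_assoc, ← hQ]
    refine hstep _ ?_
    nlinarith [hxi i, sq_nonneg (((x i : ℤ) : ℝ) - 1)]
  have hminus : ∀ i : Fin 3,
      ((600 : ℝ) + ∑ j, (((x - Pi.single i 1 : Site 3) j : ℤ) : ℝ) ^ 2) ^ (-(1 / 4 : ℝ)) ≤
        Q ^ (-(1 / 4 : ℝ)) * (1 - (1 - 2 * ((x i : ℤ) : ℝ)) / (4 * Q) +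
          3 * (1 - 2 * ((x i : ℤ) : ℝ)) ^ 2 / (16 * Q ^ 2)) := by
    intro i
    rw [sum_sq_sub_single, ← hq, ← add_assoc, ← hQ]
    refine hstep _ ?_
    nlinarith [hxi i, sq_nonneg (((x i : ℤ) : ℝ) + 1)]
  have hboth : ∀ i : Fin 3,
      ((600 : ℝ) + ∑ j, (((x + Pi.single i 1 : Site 3) j : ℤ) : ℝ) ^ 2) ^ (-(1 / 4 : ℝ)) +
          ((600 : ℝ) + ∑ j, (((x - Pi.single i 1 : Site 3) j : ℤ) : ℝ) ^ 2) ^ (-(1 / 4 : ℝ)) ≤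
        Q ^ (-(1 / 4 : ℝ)) * (2 - 1 / (2 * Q) + 3 * (2 + 8 * ((x i : ℤ) : ℝ) ^ 2) / (16 * Q ^ 2)) := by
    intro i
    have h2 := add_le_add (hplus i) (hminus i)
    have heq : Q ^ (-(1 / 4 : ℝ)) * (1 - (2 * ((x i : ℤ) : ℝ) + 1) / (4 * Q) +
          3 * (2 * ((x i : ℤ) : ℝ) + 1) ^ 2 / (16 * Q ^ 2)) +
        Q ^ (-(1 / 4 : ℝ)) * (1 - (1 - 2 * ((x i : ℤ) : ℝ)) / (4 * Q) +
          3 * (1 - 2 * ((x i : ℤ) : ℝ)) ^ 2 / (16 * Q ^ 2)) =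
        Q ^ (-(1 / 4 : ℝ)) *
          (2 - 1 / (2 * Q) + 3 * (2 + 8 * ((x i : ℤ) : ℝ) ^ 2) / (16 * Q ^ 2)) := by
      rw [← mul_add]
      congr 1
      field_simp
      ring
    linarith
  have hKsum : (∑ i : Fin 3,
      (2 - 1 / (2 * Q) + 3 * (2 + 8 * ((x i : ℤ) : ℝ) ^ 2) / (16 * Q ^ 2))) ≤ 6 := by
    have hq3 : q = ((x 0 : ℤ) : ℝ) ^ 2 + ((x 1 : ℤ) : ℝ) ^ 2 + ((x 2 : ℤ) : ℝ) ^ 2 := by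
      rw [hq, Fin.sum_univ_three]
    have hkey : (18 + 24 * q) / (16 * Q ^ 2) ≤ 3 / (2 * Q) := by
      rw [div_le_div_iff₀ (by positivity) (by positivity)]
      nlinarith
    have hexp : (∑ i : Fin 3,
        (2 - 1 / (2 * Q) + 3 * (2 + 8 * ((x i : ℤ) : ℝ) ^ 2) / (16 * Q ^ 2))) =
        6 - 3 / (2 * Q) + (18 + 24 * q) / (16 * Q ^ 2) := by
      rw [Fin.sum_univ_three, hq3]
      field_simp
      ring
    rw [hexp]
    linarith
  refine le_trans (Finset.sum_le_sum fun i _ => hboth i) ?_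
  rw [← Finset.mul_sum, mul_comm]
  exact mul_le_mul_of_nonneg_right hKsum (Real.rpow_nonneg hQpos.le _)

/-! ### The exterior maximum principle -/

/-- **Exterior maximum principle on `ℤ³`.**  Let `w : ℤ³ → ℝ` be `≤ 0` on the box
`{‖x‖∞ ≤ R}`, have finite super-level sets `{w ≥ ε}` for every `ε > 0` (e.g. `w ≤` a function
tending to `0` at infinity), and be nearest-neighbour subharmonic at every `x` with `‖x‖∞ > R`.
Then `w ≤ 0` everywhere: otherwise `w` attains a positive maximum `M`; among the (finitely many)
maximisers pick one with maximal first coordinate `x`; subharmonicity at `x` (which lies outside the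
box since `M > 0`) and `w ≤ M` force `w(x + e₀) = M`, contradicting maximality.
(Lawler–Limic 2010, §6.5, maximum principle, exterior-domain form.) -/
theorem exterior_maximum_principle (R : ℝ) (w : Site 3 → ℝ)
    (hfin : ∀ ε : ℝ, 0 < ε → {x | ε ≤ w x}.Finite)
    (hbox : ∀ x : Site 3, ‖x‖ ≤ R → w x ≤ 0)
    (hsub : ∀ x : Site 3, R < ‖x‖ →
      w x ≤ (1 / 6 : ℝ) * ∑ i : Fin 3, (w (x + Pi.single i 1) + w (x - Pi.single i 1))) :
    ∀ x, w x ≤ 0 := by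
  classical
  by_contra hcon
  push Not at hcon
  obtain ⟨x₀, hx₀⟩ := hcon
  set ε : ℝ := w x₀ with hε
  set T : Finset (Site 3) := (hfin ε hx₀).toFinset with hT
  have hmemT : ∀ y, y ∈ T ↔ ε ≤ w y := fun y => by
    rw [hT, Set.Finite.mem_toFinset]
    rfl
  have hx₀T : x₀ ∈ T := (hmemT x₀).2 le_rfl
  obtain ⟨x₁, hx₁T, hx₁max⟩ := T.exists_max_image w ⟨x₀, hx₀T⟩
  set M : ℝ := w x₁ with hM
  have hMε : ε ≤ M := (hmemT x₁).1 hx₁T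
  have hMpos : 0 < M := lt_of_lt_of_le hx₀ hMε
  have hle : ∀ y, w y ≤ M := by
    intro y
    by_cases hy : ε ≤ w y
    · exact hx₁max y ((hmemT y).2 hy)
    · exact le_trans (le_of_lt (not_le.1 hy)) hMε
  set T' : Finset (Site 3) := T.filter (fun y => w y = M) with hT'
  have hmemT' : ∀ y, y ∈ T' ↔ w y = M := by
    intro y
    rw [hT', Finset.mem_filter]
    constructor
    · exact fun h => h.2
    · intro h
      exact ⟨(hmemT y).2 (h ▸ hMε), h⟩
  have hx₁T' : x₁ ∈ T' := (hmemT' x₁).2 rfl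
  obtain ⟨x₂, hx₂T', hx₂max⟩ := T'.exists_max_image (fun y => y 0) ⟨x₁, hx₁T'⟩
  have hwx₂ : w x₂ = M := (hmemT' x₂).1 hx₂T'
  have hR : R < ‖x₂‖ := by
    by_contra h
    have := hbox x₂ (not_lt.1 h)
    linarith
  have hs := hsub x₂ hR
  rw [Fin.sum_univ_three] at hs
  have h0p := hle (x₂ + Pi.single 0 1)
  have h0m := hle (x₂ - Pi.single 0 1)
  have h1p := hle (x₂ + Pi.single 1 1)
  have h1m := hle (x₂ - Pi.single 1 1)
  have h2p := hle (x₂ + Pi.single 2 1)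
  have h2m := hle (x₂ - Pi.single 2 1)
  have heq : w (x₂ + Pi.single 0 1) = M := by linarith
  have hmem : x₂ + Pi.single 0 1 ∈ T' := (hmemT' _).2 heq
  have h' : (x₂ + Pi.single (0 : Fin 3) (1 : ℤ) : Site 3) 0 ≤ x₂ 0 := hx₂max _ hmem
  rw [Pi.add_apply, Pi.single_eq_same] at h'
  linarith

/-! ### The support item -/

open Summit.CriticalPhenomena.PercolationContinuityZ3.Theses.PercSubharmonicSquare in
/-- **Support item `ExteriorSubharmonicDecay` (stmt-CriticalPhenomena-11507), proved** with
`b = 1/2`, `C = (600 + 3R²)^{1/4}`: every `u : ℤ³ → [0,1]` tending to `0` at infinity and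
nearest-neighbour subharmonic off the box `{‖x‖∞ ≤ R}` satisfies `u x ≤ C ‖x‖∞^{-1/2}` for
`x ≠ 0`.  Proof: exterior maximum principle (`exterior_maximum_principle`) for
`w = u - C h`, `h = (600 + |x|²)^{-1/4}` lattice-superharmonic (`barrier_superharmonic`),
`C h ≥ 1 ≥ u` on the box, `{w ≥ ε} ⊆ {u ≥ ε}` finite; then `h x ≤ (‖x‖∞²)^{-1/4}`. -/
theorem exteriorSubharmonicDecay_proof : ExteriorSubharmonicDecay := by
  intro R
  refine ⟨1 / 2, ((600 : ℝ) + 3 * (R : ℝ) ^ 2) ^ (1 / 4 : ℝ), by norm_num, ?_⟩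
  intro u hu0 hu1 hlim hsub x hx
  set h : Site 3 → ℝ := fun y => ((600 : ℝ) + ∑ j, ((y j : ℤ) : ℝ) ^ 2) ^ (-(1 / 4 : ℝ))
    with hh
  set C₀ : ℝ := ((600 : ℝ) + 3 * (R : ℝ) ^ 2) ^ (1 / 4 : ℝ) with hC₀
  have hC₀pos : 0 < C₀ := Real.rpow_pos_of_pos (by positivity) _
  have hhpos : ∀ y, 0 < h y := fun y => by
    rw [hh]
    exact Real.rpow_pos_of_pos (by positivity) _
  -- `u ≤ C₀ h` everywhere, by the exterior maximum principle for `w := u - C₀ h`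
  have key : ∀ y, u y - C₀ * h y ≤ 0 := by
    refine exterior_maximum_principle (R : ℝ) (fun y => u y - C₀ * h y) ?_ ?_ ?_
    · intro ε hε
      have hev : ∀ᶠ y in Filter.cofinite, dist (u y) 0 < ε := Metric.tendsto_nhds.1 hlim ε hε
      rw [Filter.eventually_cofinite] at hev
      refine hev.subset ?_
      intro y hy
      simp only [Set.mem_setOf_eq] at hy ⊢
      rw [Real.dist_eq, sub_zero, abs_of_nonneg (hu0 y), not_lt]
      have := mul_pos hC₀pos (hhpos y)
      linarith
    · intro y hy
      show u y - C₀ * h y ≤ 0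
      have hy' : ∀ j, ((y j : ℤ) : ℝ) ^ 2 ≤ (R : ℝ) ^ 2 := by
        intro j
        have h1 : ‖y j‖ ≤ ‖y‖ := norm_le_pi_norm y j
        rw [Int.norm_eq_abs] at h1
        have h2 : |((y j : ℤ) : ℝ)| ≤ R := h1.trans hy
        calc ((y j : ℤ) : ℝ) ^ 2 = |((y j : ℤ) : ℝ)| ^ 2 := (sq_abs _).symm
          _ ≤ (R : ℝ) ^ 2 := pow_le_pow_left₀ (abs_nonneg _) h2 2
      have hsum : (600 : ℝ) + ∑ j, ((y j : ℤ) : ℝ) ^ 2 ≤ 600 + 3 * (R : ℝ) ^ 2 := by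
        rw [Fin.sum_univ_three]
        linarith [hy' 0, hy' 1, hy' 2]
      have hhy : ((600 : ℝ) + 3 * (R : ℝ) ^ 2) ^ (-(1 / 4 : ℝ)) ≤ h y := by
        rw [hh]
        exact Real.rpow_le_rpow_of_nonpos (by positivity) hsum (by norm_num)
      have hone : C₀ * ((600 : ℝ) + 3 * (R : ℝ) ^ 2) ^ (-(1 / 4 : ℝ)) = 1 := by
        rw [hC₀, ← Real.rpow_add (by positivity)]
        norm_num
      have hC := mul_le_mul_of_nonneg_left hhy hC₀pos.le
      linarith [hu1 y]
    · intro y hy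
      have hu := hsub y hy
      have hb := mul_le_mul_of_nonneg_left (barrier_superharmonic y) hC₀pos.le
      rw [Fin.sum_univ_three] at hu hb ⊢
      simp only [hh]
      linarith
  -- conclusion: `u x ≤ C₀ h x ≤ C₀ ‖x‖^{-1/2}`
  have hux : u x ≤ C₀ * h x := by linarith [key x]
  have hnorm : 0 < ‖x‖ := norm_pos_iff.2 hx
  have hq0 : 0 ≤ ∑ j, ((x j : ℤ) : ℝ) ^ 2 := Finset.sum_nonneg fun j _ => sq_nonneg _
  have hnx : ‖x‖ ^ 2 ≤ (600 : ℝ) + ∑ j, ((x j : ℤ) : ℝ) ^ 2 := by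
    have h1 : ‖x‖ ≤ Real.sqrt (∑ j, ((x j : ℤ) : ℝ) ^ 2) := by
      refine (pi_norm_le_iff_of_nonneg (Real.sqrt_nonneg _)).2 fun j => ?_
      rw [Int.norm_eq_abs]
      exact Real.abs_le_sqrt
        (Finset.single_le_sum (f := fun j => ((x j : ℤ) : ℝ) ^ 2) (fun j _ => sq_nonneg _)
          (Finset.mem_univ j))
    have h2 : ‖x‖ ^ 2 ≤ ∑ j, ((x j : ℤ) : ℝ) ^ 2 := by
      calc ‖x‖ ^ 2 ≤ (Real.sqrt (∑ j, ((x j : ℤ) : ℝ) ^ 2)) ^ 2 :=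
            pow_le_pow_left₀ (norm_nonneg _) h1 2
        _ = ∑ j, ((x j : ℤ) : ℝ) ^ 2 := Real.sq_sqrt hq0
    linarith
  have hhx : h x ≤ ‖x‖ ^ (-(1 / 2 : ℝ)) := by
    calc h x ≤ (‖x‖ ^ 2) ^ (-(1 / 4 : ℝ)) := by
          rw [hh]
          exact Real.rpow_le_rpow_of_nonpos (by positivity) hnx (by norm_num)
      _ = ‖x‖ ^ (-(1 / 2 : ℝ)) := by
          rw [← Real.rpow_natCast, ← Real.rpow_mul hnorm.le]
          norm_num
  calc u x ≤ C₀ * h x := hux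
    _ ≤ C₀ * ‖x‖ ^ (-(1 / 2 : ℝ)) := mul_le_mul_of_nonneg_left hhx hC₀pos.le

end Summit.CriticalPhenomena.PercolationContinuityZ3.Theorems
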